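import Literature.NumberTheory.LFunctions.MauduitRivatTypeIIMiddleDigits
import Literature.NumberTheory.LFunctions.MauduitRivatDiscreteFejer
import Literature.NumberTheory.LFunctions.MauduitRivatSmoothingError
import HarnessLib

/-!
# Mauduit–Rivat's type-II estimate for unitary matrices, step 3: smoothing the middle-digit conditions ((64) of Mauduit–Rivat 2015 in discrete Fejér form; proved)

Everything in this file is PROVED (plus plain definitions). In `S₃(s)` (`corrS3`,
`MauduitRivatTypeIIMiddleDigits.lean`) the summand depends on `(m, n)` through the middle digits
`u₀ = r_{μ₀,μ₂}(mn)` and `u₁ = r_{μ₀,μ₂}(mn+mr)` only. C. Mauduit, J. Rivat, J. Eur. Math. Soc. 17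
(2015), p. 2613–2614 detect `r_{μ₀,μ₂}(x) = u` by the indicator `χ_α(x/q^{μ₂} − u/q^{μ₂−μ₀})`,
`α = q^{μ₀−μ₂}`, and replace it by Vaaler's trigonometric polynomials `A_{α,H}` (Lemmas 1–2, (64)).
As in the tree's `MauduitRivatDiscreteFejer.lean` / `MauduitRivatSmoothingError.lean` we use instead a
DISCRETE smoothing on `ℤ/k^{μ₂}` by the normalised Fejér kernel `Φ = fejerPhi K H` (`K = k^{μ₂}`):

* `smoothInd K L H u x = ∑_{y ∈ [uL, uL+L)} Φ(x + K − y)` — the smoothed indicator of the block of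
  middle digits `u` (`L = k^{μ₀}`); `smoothInd_nonneg`, `sum_smoothInd_eq_one` (`∑_{u<K/L} = 1`),
  `smoothInd_le_one`;
* `one_sub_smoothInd_le` — **the pointwise error**: `1 − smoothInd (r(x)) x ≤ min(1, K/(H·T(x)))`,
  `T = gridDist L x` the distance of `x` to the boundary of its block (the mass of `Φ` at circular
  distance `≥ T`, `sum_fejerPhi_tail_le`), and `sum_abs_indicator_sub_smoothInd_le` —
  `∑_u |𝟙[r(x)=u] − smoothInd u x| ≤ 2 min(1, K/(HT(x)))`;
* `sum_abs_indicator_mul_sub_le` — the two-dimensional version (MR Lemma 2):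
  `∑_{u₀,u₁} |𝟙[r(x)=u₀]𝟙[r(x')=u₁] − A_{u₀}(x)A_{u₁}(x')| ≤ 2min(1,K/(HT x)) + 2min(1,K/(HT x'))`;
* `corrS4` — MR's `S₄(r,s)` summed over `r` (matrix order as in Müllner):
  `∑_r ∑_n ∑_m e(ϑ s k^{μ₁} r) ∑_{u₀,u₁} A_{u₀}(mn) A_{u₁}(mn+mr) tr U(g(u₁+s̃(n+r)) g(u₀+s̃n)⁻¹ g(u₀) g(u₁)⁻¹)`;
* `norm_corrS3_sub_corrS4_le` — **(64) with explicit errors**: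
  `|S₃(s) − S₄(s)| ≤ 2d ∑_r ∑_n ∑_m (min(1, K/(HT(mn))) + min(1, K/(HT(mn+mr))))`, the right-hand side
  being what `sum_box_min_le` (boundary-layer counting, replacing MR §6.1–6.2) controls.

## References
* C. Mauduit, J. Rivat, J. Eur. Math. Soc. 17 (2015): Lemmas 1–2, (11)–(18), (64) (pp. 2599–2601,
  2613–2614). [MauduitRivat2015]
* C. Müllner, Duke Math. J. 166 (2017) = arXiv:1602.03042, §5.4.2 (S₃, S₄). [Mullner2017]
-/

noncomputable section

open Finset Complex Matrix
open scoped FourierTransform InnerProductSpace ComplexConjugate Matrix.Norms.Frobenius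

namespace Literature.NumberTheory.LFunctions.MauduitRivat

/-! ## Periodic sums -/

/-- A `K`-periodic function has the same sum over every `K` consecutive integers. [folklore] -/
theorem sum_range_add_of_periodic {K : ℕ} {h : ℕ → ℝ} (hper : ∀ n, h (n + K) = h n) (c : ℕ) :
    ∑ z ∈ range K, h (c + z) = ∑ z ∈ range K, h z := by
  induction c with
  | zero => simp
  | succ c ih =>
    have e : ∀ z, h (c + 1 + z) = h (c + (z + 1)) := fun z => by ring_nf
    simp_rw [e]
    have h1 := sum_range_succ' (fun i => h (c + i)) K
    have h2 := sum_range_succ (fun i => h (c + i)) K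
    simp only [add_zero] at h1
    rw [hper c] at h2
    linarith

/-- The blocks `[uL, uL+L)`, `u < n`, tile `[0, nL)`. [folklore] -/
theorem sum_range_sum_Ico_block (g : ℕ → ℝ) (L n : ℕ) :
    ∑ u ∈ range n, ∑ y ∈ Ico (u * L) (u * L + L), g y = ∑ y ∈ range (n * L), g y := by
  induction n with
  | zero => simp
  | succ n ih =>
    rw [sum_range_succ, ih, Nat.succ_mul, ← sum_range_add_sum_Ico _ (Nat.le_add_right (n * L) L)]

/-! ## The smoothed block indicators -/

/-- The smoothed indicator of the block `[uL, uL+L)` modulo `K`: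
`A_u(x) = ∑_{uL ≤ y < uL+L} Φ(x + K − y)`, `Φ = fejerPhi K H` (for `y ≤ K`, `x + K − y ≡ x − y`).
[cite: MauduitRivat2015, (13)–(14) (discrete Fejér substitute)] -/
def smoothInd (K L H : ℕ) (u x : ℕ) : ℝ :=
  ∑ y ∈ Ico (u * L) (u * L + L), fejerPhi K H (x + (K - y))

/-- `A_u(x) ≥ 0`. [folklore] -/
theorem smoothInd_nonneg (K L H u x : ℕ) : 0 ≤ smoothInd K L H u x :=
  sum_nonneg fun _ _ => fejerPhi_nonneg _ _ _

/-- **`∑_{u<K'} A_u(x) = 1`** for `K = K'·L`, `1 ≤ H ≤ K` (the blocks tile `[0, K)` and `Φ` has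
total mass `1`). [cite: MauduitRivat2015, Lemma 1 (a₀ = α) — discrete analogue] -/
theorem sum_smoothInd_eq_one {K K' L H : ℕ} (hK : K = K' * L) (hH : 0 < H) (hHK : H ≤ K) (x : ℕ) :
    ∑ u ∈ range K', smoothInd K L H u x = 1 := by
  have hKpos : 0 < K := lt_of_lt_of_le hH hHK
  -- the blocks tile `range K`
  have htile : ∑ u ∈ range K', smoothInd K L H u x = ∑ y ∈ range K, fejerPhi K H (x + (K - y)) := by
    unfold smoothInd
    rw [sum_range_sum_Ico_block, ← hK]
  rw [htile]
  -- reindex `y ↦ K − 1 − y` and use periodicity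
  have hper : ∀ n, fejerPhi K H (n + K) = fejerPhi K H n := fun n => by
    simpa using fejerPhi_add_mul K H n 1
  calc ∑ y ∈ range K, fejerPhi K H (x + (K - y))
      = ∑ z ∈ range K, fejerPhi K H (x + 1 + z) := by
        rw [← sum_range_reflect]
        refine sum_congr rfl fun z hz => ?_
        have hz' := mem_range.1 hz
        congr 1; omega
    _ = ∑ a ∈ range K, fejerPhi K H a := sum_range_add_of_periodic hper (x + 1)
    _ = 1 := sum_range_fejerPhi hH hHK

/-- `A_u(x) ≤ 1` (`u < K'`). [folklore] -/
theorem smoothInd_le_one {K K' L H : ℕ} (hK : K = K' * L) (hH : 0 < H) (hHK : H ≤ K) {u : ℕ}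
    (hu : u < K') (x : ℕ) : smoothInd K L H u x ≤ 1 := by
  rw [← sum_smoothInd_eq_one hK hH hHK x]
  exact single_le_sum (fun v _ => smoothInd_nonneg K L H v x) (mem_range.2 hu)

/-! ## The pointwise smoothing error -/

/-- Geometry of the blocks: if `y < K` lies outside the block of `x` (i.e. `⌊(x mod K)/L⌋ ≠ ⌊y/L⌋`),
then the residue `a = (x + K − y) mod K` is at circular distance `≥ T(x) = gridDist L x` from `0`.
[folklore] -/
theorem gridDist_le_of_ne_block {K K' L : ℕ} (hK : K = K' * L) (hL : 0 < L) {x y : ℕ} (hy : y < K)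
    (hne : y / L ≠ x % K / L) :
    gridDist L x ≤ min ((x + (K - y)) % K) (K - (x + (K - y)) % K) := by
  have hKpos : 0 < K := by omega
  set xr := x % K with hxr
  have hxrlt : xr < K := Nat.mod_lt _ hKpos
  have hxmodL : x % L = xr % L := by
    rw [hxr, hK, Nat.mod_mul_left_mod]
  rw [gridDist_apply, hxmodL]
  -- the block of `xr` is `[uL, uL+L)` with `u = xr / L`
  have hblock1 : xr / L * L ≤ xr := Nat.div_mul_le_self _ _
  have hblock2 : xr < xr / L * L + L := by
    have := Nat.lt_succ_iff.2 (le_refl (xr / L))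
    have h := Nat.div_add_mod xr L
    have hm : xr % L < L := Nat.mod_lt _ hL
    rw [mul_comm]; omega
  have hxrL : xr % L = xr - xr / L * L := by
    have h := Nat.div_add_mod xr L
    rw [mul_comm] at h; omega
  -- the residue `a`
  have ha : (x + (K - y)) % K = (xr + (K - y)) % K := by
    rw [hxr, Nat.add_mod x]
    conv_rhs => rw [Nat.add_mod, Nat.mod_mod]
  rw [ha]
  -- case distinction on the position of `y` relative to the block
  rcases lt_or_ge y (xr / L * L) with hlt | hge
  · -- `y` below the block: `a = xr − y` after reduction
    have hyx : y ≤ xr := by omega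
    have hres : (xr + (K - y)) % K = xr - y := by
      rw [show xr + (K - y) = (xr - y) + K by omega, Nat.add_mod_right, Nat.mod_eq_of_lt (by omega)]
    rw [hres]
    apply le_min
    · -- `xr − y ≥ xr − uL + 1 = xr % L + 1`
      omega
    · -- `K − (xr − y) ≥ K − xr ≥ uL + L − xr = L − xr % L`
      have : xr / L * L + L ≤ K := by
        have h1 : xr / L < K' := by
          rw [hK] at hxrlt
          exact Nat.div_lt_of_lt_mul (by rw [mul_comm]; exact hxrlt)
        calc xr / L * L + L = (xr / L + 1) * L := by ring
          _ ≤ K' * L := Nat.mul_le_mul_right _ h1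
          _ = K := hK.symm
      omega
  · -- `y` above the block (it is not inside, by `hne`)
    have habove : xr / L * L + L ≤ y := by
      by_contra h
      rw [not_le] at h
      apply hne
      -- `y` in the block `[uL, uL+L)` has `y / L = u`
      have : y / L = xr / L := by
        apply Nat.div_eq_of_lt_le
        · exact hge
        · show y < (xr / L + 1) * L
          rw [add_mul, one_mul]; exact h
      exact this
    have hyx : xr < y := by omega
    have hres : (xr + (K - y)) % K = xr + (K - y) := Nat.mod_eq_of_lt (by omega)
    rw [hres]
    apply le_min
    · omega
    · omega

/-- **The pointwise smoothing error**: with `u* = ⌊(x mod K)/L⌋` (the block of `x`), `K = K'L`,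
`1 ≤ H ≤ K`, `L ≥ 1`: `1 − A_{u*}(x) ≤ min(1, K/(H·gridDist L x))`.
[cite: MauduitRivat2015, Lemma 1 ((13), (15)) — discrete analogue via `sum_fejerPhi_tail_le`] -/
theorem one_sub_smoothInd_le {K K' L H : ℕ} (hK : K = K' * L) (hL : 0 < L) (hH : 0 < H) (hHK : H ≤ K)
    (x : ℕ) :
    1 - smoothInd K L H (x % K / L) x ≤ min 1 ((K : ℝ) / (H * gridDist L x)) := by
  have hKpos : 0 < K := lt_of_lt_of_le hH hHK
  refine le_min (by linarith [smoothInd_nonneg K L H (x % K / L) x]) ?_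
  -- `1 − A_{u*}(x) = ∑_{y<K, y ∉ block} Φ(x + K − y)`
  set u := x % K / L with hu
  have hublock : u * L + L ≤ K := by
    have h1 : u < K' := by
      rw [hu]
      apply Nat.div_lt_of_lt_mul
      rw [mul_comm, ← hK]
      exact Nat.mod_lt _ hKpos
    calc u * L + L = (u + 1) * L := by ring
      _ ≤ K' * L := Nat.mul_le_mul_right _ h1
      _ = K := hK.symm
  have hsplit : (1 : ℝ) - smoothInd K L H u x =
      ∑ y ∈ (range K).filter (fun y => ¬ (u * L ≤ y ∧ y < u * L + L)), fejerPhi K H (x + (K - y)) := by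
    have htot : ∑ y ∈ range K, fejerPhi K H (x + (K - y)) = 1 := by
      have h := sum_smoothInd_eq_one hK hH hHK x
      unfold smoothInd at h
      rwa [sum_range_sum_Ico_block, ← hK] at h
    rw [← htot, ← sum_filter_add_sum_filter_not (range K) (fun y => u * L ≤ y ∧ y < u * L + L)]
    have hblock : (range K).filter (fun y => u * L ≤ y ∧ y < u * L + L) = Ico (u * L) (u * L + L) := by
      ext y
      simp only [mem_filter, mem_range, mem_Ico]
      omega
    rw [hblock, smoothInd]
    ring
  rw [hsplit]
  -- inject the complement into the tail set of `Φ`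
  set T := gridDist L x with hT
  have hT1 : 1 ≤ T := one_le_gridDist L x
  calc ∑ y ∈ (range K).filter (fun y => ¬ (u * L ≤ y ∧ y < u * L + L)), fejerPhi K H (x + (K - y))
      = ∑ y ∈ (range K).filter (fun y => ¬ (u * L ≤ y ∧ y < u * L + L)), fejerPhi K H ((x + (K - y)) % K) :=
        sum_congr rfl fun y _ => (fejerPhi_mod K H _).symm
    _ = ∑ a ∈ ((range K).filter (fun y => ¬ (u * L ≤ y ∧ y < u * L + L))).image (fun y => (x + (K - y)) % K),
          fejerPhi K H a := by
        refine (sum_image fun y hy y' hy' h => ?_).symm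
        -- injectivity of `y ↦ (x + K − y) mod K` on `y < K`
        rw [mem_coe, mem_filter, mem_range] at hy hy'
        have hmod : (x + (K - y)) ≡ (x + (K - y')) [MOD K] := h
        have e : x + (K - y) + y = x + (K - y') + y' := by omega
        have h2 : x + (K - y') + y' ≡ x + (K - y') + y [MOD K] := by
          calc x + (K - y') + y' = x + (K - y) + y := e.symm
            _ ≡ x + (K - y') + y [MOD K] := hmod.add_right y
        have h3 := Nat.ModEq.add_left_cancel' (x + (K - y')) h2
        exact (Nat.ModEq.eq_of_lt_of_lt h3 hy'.1 hy.1).symm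
    _ ≤ ∑ a ∈ (range K).filter (fun a => T ≤ min a (K - a)), fejerPhi K H a := by
        refine sum_le_sum_of_subset_of_nonneg (image_subset_iff.2 fun y hy => ?_) (fun a _ _ => fejerPhi_nonneg _ _ _)
        · rw [mem_filter, mem_range] at hy
          rw [mem_filter, mem_range]
          refine ⟨Nat.mod_lt _ hKpos, ?_⟩
          have hne : y / L ≠ x % K / L := by
            intro h
            apply hy.2
            have h1 := Nat.div_mul_le_self y L
            have h2 : y < y / L * L + L := by
              have := Nat.div_add_mod y L
              have hm : y % L < L := Nat.mod_lt _ hL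
              rw [mul_comm]; omega
            rw [h] at h1 h2
            exact ⟨h1, h2⟩
          exact gridDist_le_of_ne_block hK hL hy.1 hne
    _ ≤ (K : ℝ) / (H * T) := sum_fejerPhi_tail_le hH hKpos hT1

/-! ## The `L¹` smoothing errors -/

/-- **The one-dimensional smoothing error** (MR Lemma 1 / (13) in `ℓ¹(u)` form): with
`r(x) = ⌊(x mod K)/L⌋`, `K = K'L`, `1 ≤ H ≤ K`, `L ≥ 1`,
`∑_{u<K'} |𝟙[r(x) = u] − A_u(x)| ≤ 2 min(1, K/(H · gridDist L x))`.
[cite: MauduitRivat2015, Lemma 1 (discrete analogue)] -/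
theorem sum_abs_indicator_sub_smoothInd_le {K K' L H : ℕ} (hK : K = K' * L) (hL : 0 < L) (hH : 0 < H)
    (hHK : H ≤ K) (x : ℕ) :
    ∑ u ∈ range K', |(if x % K / L = u then (1 : ℝ) else 0) - smoothInd K L H u x| ≤
      2 * min 1 ((K : ℝ) / (H * gridDist L x)) := by
  have hKpos : 0 < K := lt_of_lt_of_le hH hHK
  set us := x % K / L with hus
  have husK : us < K' := by
    rw [hus]; apply Nat.div_lt_of_lt_mul; rw [mul_comm, ← hK]; exact Nat.mod_lt _ hKpos
  have hterm : ∀ u ∈ range K', |(if us = u then (1 : ℝ) else 0) - smoothInd K L H u x| =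
      smoothInd K L H u x + (if us = u then 1 - 2 * smoothInd K L H u x else 0) := by
    intro u hu
    have h0 := smoothInd_nonneg K L H u x
    have h1 := smoothInd_le_one hK hH hHK (mem_range.1 hu) x
    split_ifs with h
    · rw [abs_of_nonneg (by linarith)]; ring
    · rw [zero_sub, abs_neg, abs_of_nonneg h0]; ring
  rw [sum_congr rfl hterm, sum_add_distrib, sum_smoothInd_eq_one hK hH hHK x, sum_ite_eq, if_pos (mem_range.2 husK)]
  have h := one_sub_smoothInd_le hK hL hH hHK x
  rw [← hus] at h
  linarith

/-- **The two-dimensional smoothing error** (MR Lemma 2, (18), in `ℓ¹` form):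
`∑_{u₀,u₁<K'} |𝟙[r(x)=u₀]𝟙[r(x')=u₁] − A_{u₀}(x)A_{u₁}(x')| ≤ 2min(1, K/(HT(x))) + 2min(1, K/(HT(x')))`.
[cite: MauduitRivat2015, Lemma 2] -/
theorem sum_abs_indicator_mul_sub_le {K K' L H : ℕ} (hK : K = K' * L) (hL : 0 < L) (hH : 0 < H)
    (hHK : H ≤ K) (x x' : ℕ) :
    ∑ u₀ ∈ range K', ∑ u₁ ∈ range K',
        |(if x % K / L = u₀ then (1 : ℝ) else 0) * (if x' % K / L = u₁ then (1 : ℝ) else 0) -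
          smoothInd K L H u₀ x * smoothInd K L H u₁ x'| ≤
      2 * min 1 ((K : ℝ) / (H * gridDist L x)) + 2 * min 1 ((K : ℝ) / (H * gridDist L x')) := by
  have hKpos : 0 < K := lt_of_lt_of_le hH hHK
  set χ : ℕ → ℕ → ℝ := fun z u => if z % K / L = u then 1 else 0 with hχ
  set A : ℕ → ℕ → ℝ := fun z u => smoothInd K L H u z with hA
  have hχ0 : ∀ z u, 0 ≤ χ z u := fun z u => by rw [hχ]; dsimp only; split_ifs <;> norm_num
  have hA0 : ∀ z u, 0 ≤ A z u := fun z u => smoothInd_nonneg K L H u z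
  have hχsum : ∀ z, ∑ u ∈ range K', χ z u = 1 := by
    intro z
    have hlt : z % K / L < K' := by
      apply Nat.div_lt_of_lt_mul; rw [mul_comm, ← hK]; exact Nat.mod_lt _ hKpos
    rw [hχ]; dsimp only
    rw [sum_ite_eq, if_pos (mem_range.2 hlt)]
  have hAsum : ∀ z, ∑ u ∈ range K', A z u = 1 := fun z => sum_smoothInd_eq_one hK hH hHK z
  -- pointwise: `|χ₀χ₁ − A₀A₁| ≤ χ₀|χ₁ − A₁| + |χ₀ − A₀| A₁`
  have hpt : ∀ u₀ u₁, |χ x u₀ * χ x' u₁ - A x u₀ * A x' u₁| ≤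
      χ x u₀ * |χ x' u₁ - A x' u₁| + |χ x u₀ - A x u₀| * A x' u₁ := by
    intro u₀ u₁
    have e : χ x u₀ * χ x' u₁ - A x u₀ * A x' u₁ =
        χ x u₀ * (χ x' u₁ - A x' u₁) + (χ x u₀ - A x u₀) * A x' u₁ := by ring
    rw [e]
    refine (abs_add_le _ _).trans ?_
    rw [abs_mul, abs_mul, abs_of_nonneg (hχ0 x u₀), abs_of_nonneg (hA0 x' u₁)]
  calc ∑ u₀ ∈ range K', ∑ u₁ ∈ range K', |χ x u₀ * χ x' u₁ - A x u₀ * A x' u₁|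
      ≤ ∑ u₀ ∈ range K', ∑ u₁ ∈ range K', (χ x u₀ * |χ x' u₁ - A x' u₁| + |χ x u₀ - A x u₀| * A x' u₁) :=
        sum_le_sum fun u₀ _ => sum_le_sum fun u₁ _ => hpt u₀ u₁
    _ = (∑ u₀ ∈ range K', χ x u₀) * (∑ u₁ ∈ range K', |χ x' u₁ - A x' u₁|) +
          (∑ u₀ ∈ range K', |χ x u₀ - A x u₀|) * (∑ u₁ ∈ range K', A x' u₁) := by
        rw [sum_mul_sum, sum_mul_sum, ← sum_add_distrib]
        exact sum_congr rfl fun u₀ _ => by rw [← sum_add_distrib]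
    _ = ∑ u₁ ∈ range K', |χ x' u₁ - A x' u₁| + ∑ u₀ ∈ range K', |χ x u₀ - A x u₀| := by
        rw [hχsum, hAsum, one_mul, mul_one]
    _ ≤ 2 * min 1 ((K : ℝ) / (H * gridDist L x')) + 2 * min 1 ((K : ℝ) / (H * gridDist L x)) :=
        add_le_add (sum_abs_indicator_sub_smoothInd_le hK hL hH hHK x')
          (sum_abs_indicator_sub_smoothInd_le hK hL hH hHK x)
    _ = _ := by ring

/-! ## `S₄(s)` and the smoothing step (64) -/

variable {d : Type*} [Fintype d] [DecidableEq d] {G : Type*} [Group G]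

/-- The trace of the four-fold word for prescribed middle digits `u₀, u₁`:
`tr U(g(u₁+s̃(n+r)) g(u₀+s̃n)⁻¹ g(u₀) g(u₁)⁻¹)`, `s̃ = s k^{μ₁−μ₀}`. [cite: MauduitRivat2015, (63)–(64)]
[cite: Mullner2017, §5.4.2 (S₃, S₄)] -/
def wordTrace (U : G →* unitaryGroup d ℂ) (f : ℕ → G) (k μ₀ μ₁ μ₂ : ℕ) (s n r u₀ u₁ : ℕ) : ℂ :=
  trace (U (midFun k μ₀ μ₁ μ₂ f (u₁ + s * k ^ (μ₁ - μ₀) * (n + r)) *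
    (midFun k μ₀ μ₁ μ₂ f (u₀ + s * k ^ (μ₁ - μ₀) * n))⁻¹ *
    midFun k μ₀ μ₁ μ₂ f u₀ * (midFun k μ₀ μ₁ μ₂ f u₁)⁻¹) : Matrix d d ℂ)

/-- `|tr U(·)| ≤ d`. [folklore] -/
theorem norm_wordTrace_le (U : G →* unitaryGroup d ℂ) (f : ℕ → G) (k μ₀ μ₁ μ₂ s n r u₀ u₁ : ℕ) :
    ‖wordTrace U f k μ₀ μ₁ μ₂ s n r u₀ u₁‖ ≤ Fintype.card d :=
  norm_trace_coe_unitary_le _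

/-- **MR's `S₄(r, s)` summed over `r`, for unitary matrices** (smoothed middle-digit conditions):
`S₄(s) = ∑_{1≤r<R} ∑_{n} ∑_{m, m+sk^{μ₁}<M₁} e(ϑ s k^{μ₁} r) ∑_{u₀,u₁<k^{μ₂−μ₀}} A_{u₀}(mn) A_{u₁}(mn+mr) tr U(word)`.
[cite: MauduitRivat2015, (64) (S₄)] [cite: Mullner2017, §5.4.2 (S₄)] -/
def corrS4 (U : G →* unitaryGroup d ℂ) (f : ℕ → G) (k μ₀ μ₁ μ₂ Hs : ℕ) (ϑ : ℝ)
    (M₀ M₁ N₀ N₁ R s : ℕ) : ℂ :=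
  ∑ r ∈ Ico 1 R, ∑ n ∈ Ico N₀ N₁, ∑ m ∈ (Ico M₀ M₁).filter (fun m => m + s * k ^ μ₁ < M₁),
    (𝐞 (ϑ * (s * ((k ^ μ₁ : ℕ) : ℝ)) * r) : ℂ) *
      ∑ u₀ ∈ range (k ^ (μ₂ - μ₀)), ∑ u₁ ∈ range (k ^ (μ₂ - μ₀)),
        ((smoothInd (k ^ μ₂) (k ^ μ₀) Hs u₀ (m * n) * smoothInd (k ^ μ₂) (k ^ μ₀) Hs u₁ (m * n + m * r) : ℝ) : ℂ) *
          wordTrace U f k μ₀ μ₁ μ₂ s n r u₀ u₁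

/-- The summand of `S₃(s)` as a double sum over prescribed digits with indicators. [folklore] -/
theorem wordTrace_midDigit_eq_sum (U : G →* unitaryGroup d ℂ) (f : ℕ → G) {k : ℕ} (hk : 0 < k)
    {μ₀ μ₂ : ℕ} (hμ : μ₀ ≤ μ₂) (μ₁ s n r x x' : ℕ) :
    wordTrace U f k μ₀ μ₁ μ₂ s n r (midDigit k μ₀ μ₂ x) (midDigit k μ₀ μ₂ x') =
      ∑ u₀ ∈ range (k ^ (μ₂ - μ₀)), ∑ u₁ ∈ range (k ^ (μ₂ - μ₀)),
        (((if x % k ^ μ₂ / k ^ μ₀ = u₀ then (1 : ℝ) else 0) *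
            (if x' % k ^ μ₂ / k ^ μ₀ = u₁ then (1 : ℝ) else 0) : ℝ) : ℂ) *
          wordTrace U f k μ₀ μ₁ μ₂ s n r u₀ u₁ := by
  have h0 : x % k ^ μ₂ / k ^ μ₀ < k ^ (μ₂ - μ₀) := midDigit_lt hk hμ x
  have h1 : x' % k ^ μ₂ / k ^ μ₀ < k ^ (μ₂ - μ₀) := midDigit_lt hk hμ x'
  show wordTrace U f k μ₀ μ₁ μ₂ s n r (x % k ^ μ₂ / k ^ μ₀) (x' % k ^ μ₂ / k ^ μ₀) = _
  have e : ∀ u₀ u₁ : ℕ, (((if x % k ^ μ₂ / k ^ μ₀ = u₀ then (1 : ℝ) else 0) *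
      (if x' % k ^ μ₂ / k ^ μ₀ = u₁ then (1 : ℝ) else 0) : ℝ) : ℂ) * wordTrace U f k μ₀ μ₁ μ₂ s n r u₀ u₁ =
      if x % k ^ μ₂ / k ^ μ₀ = u₀ then
        (if x' % k ^ μ₂ / k ^ μ₀ = u₁ then wordTrace U f k μ₀ μ₁ μ₂ s n r u₀ u₁ else 0) else 0 := by
    intro u₀ u₁
    split_ifs <;> simp
  simp_rw [e]
  rw [sum_eq_single_of_mem (x % k ^ μ₂ / k ^ μ₀) (mem_range.2 h0) (fun u₀ _ hne =>
    sum_eq_zero fun u₁ _ => if_neg (Ne.symm hne))]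
  simp only [if_true, sum_ite_eq, mem_range, h1]

/-- **The smoothing step (64) with explicit errors, for unitary matrices**: for `μ₀ ≤ μ₂`, `k ≥ 1`,
`1 ≤ H ≤ k^{μ₂}`,
`|S₃(s) − S₄(s)| ≤ 2d ∑_{1≤r<R} ∑_n ∑_{m, m+sk^{μ₁}<M₁} (min(1, k^{μ₂}/(H T(mn))) + min(1, k^{μ₂}/(H T(mn+mr))))`,
`T = gridDist k^{μ₀}`. [cite: MauduitRivat2015, (64)–(65)] [cite: Mullner2017, §5.4.2] -/
theorem norm_corrS3_sub_corrS4_le (U : G →* unitaryGroup d ℂ) (f : ℕ → G) {k : ℕ} (hk : 0 < k)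
    {μ₀ μ₁ μ₂ Hs : ℕ} (hμ : μ₀ ≤ μ₂) (hH : 0 < Hs) (hHK : Hs ≤ k ^ μ₂) (ϑ : ℝ) (M₀ M₁ N₀ N₁ R s : ℕ) :
    ‖corrS3 U f k μ₀ μ₁ μ₂ ϑ M₀ M₁ N₀ N₁ R s - corrS4 U f k μ₀ μ₁ μ₂ Hs ϑ M₀ M₁ N₀ N₁ R s‖ ≤
      2 * Fintype.card d * ∑ r ∈ Ico 1 R, ∑ n ∈ Ico N₀ N₁, ∑ m ∈ (Ico M₀ M₁).filter (fun m => m + s * k ^ μ₁ < M₁),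
        (min 1 ((k ^ μ₂ : ℝ) / (Hs * gridDist (k ^ μ₀) (m * n))) +
          min 1 ((k ^ μ₂ : ℝ) / (Hs * gridDist (k ^ μ₀) (m * n + m * r)))) := by
  have hK : k ^ μ₂ = k ^ (μ₂ - μ₀) * k ^ μ₀ := by rw [← pow_add, Nat.sub_add_cancel hμ]
  have hL : 0 < k ^ μ₀ := by positivity
  set K' := k ^ (μ₂ - μ₀) with hK'
  -- termwise difference
  set D : ℕ → ℕ → ℕ → ℂ := fun r n m =>
    (𝐞 (ϑ * (s * ((k ^ μ₁ : ℕ) : ℝ)) * r) : ℂ) *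
      ∑ u₀ ∈ range K', ∑ u₁ ∈ range K',
        (((if m * n % k ^ μ₂ / k ^ μ₀ = u₀ then (1 : ℝ) else 0) *
              (if (m * n + m * r) % k ^ μ₂ / k ^ μ₀ = u₁ then (1 : ℝ) else 0) -
            smoothInd (k ^ μ₂) (k ^ μ₀) Hs u₀ (m * n) * smoothInd (k ^ μ₂) (k ^ μ₀) Hs u₁ (m * n + m * r) : ℝ) : ℂ) *
          wordTrace U f k μ₀ μ₁ μ₂ s n r u₀ u₁ with hD
  have hdiff : corrS3 U f k μ₀ μ₁ μ₂ ϑ M₀ M₁ N₀ N₁ R s - corrS4 U f k μ₀ μ₁ μ₂ Hs ϑ M₀ M₁ N₀ N₁ R s =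
      ∑ r ∈ Ico 1 R, ∑ n ∈ Ico N₀ N₁, ∑ m ∈ (Ico M₀ M₁).filter (fun m => m + s * k ^ μ₁ < M₁), D r n m := by
    rw [corrS3, corrS4, ← sum_sub_distrib]
    refine sum_congr rfl fun r _ => ?_
    rw [← sum_sub_distrib]
    refine sum_congr rfl fun n _ => ?_
    rw [← sum_sub_distrib]
    refine sum_congr rfl fun m _ => ?_
    rw [hD]; dsimp only
    rw [← wordTrace, wordTrace_midDigit_eq_sum U f hk hμ, ← mul_sub, ← sum_sub_distrib]
    congr 1
    refine sum_congr rfl fun u₀ _ => ?_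
    rw [← sum_sub_distrib]
    refine sum_congr rfl fun u₁ _ => ?_
    rw [← sub_mul]
    push_cast
    ring
  -- termwise bound
  have hbound : ∀ r n m, ‖D r n m‖ ≤ 2 * Fintype.card d *
      (min 1 ((k ^ μ₂ : ℝ) / (Hs * gridDist (k ^ μ₀) (m * n))) +
        min 1 ((k ^ μ₂ : ℝ) / (Hs * gridDist (k ^ μ₀) (m * n + m * r)))) := by
    intro r n m
    rw [hD]; dsimp only
    rw [norm_mul, norm_fourierChar, one_mul]
    have h2 := sum_abs_indicator_mul_sub_le hK hL hH hHK (H := Hs) (m * n) (m * n + m * r)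
    calc ‖∑ u₀ ∈ range K', ∑ u₁ ∈ range K',
          (((if m * n % k ^ μ₂ / k ^ μ₀ = u₀ then (1 : ℝ) else 0) *
                (if (m * n + m * r) % k ^ μ₂ / k ^ μ₀ = u₁ then (1 : ℝ) else 0) -
              smoothInd (k ^ μ₂) (k ^ μ₀) Hs u₀ (m * n) * smoothInd (k ^ μ₂) (k ^ μ₀) Hs u₁ (m * n + m * r) : ℝ) : ℂ) *
            wordTrace U f k μ₀ μ₁ μ₂ s n r u₀ u₁‖
        ≤ ∑ u₀ ∈ range K', ∑ u₁ ∈ range K',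
            |((if m * n % k ^ μ₂ / k ^ μ₀ = u₀ then (1 : ℝ) else 0) *
                (if (m * n + m * r) % k ^ μ₂ / k ^ μ₀ = u₁ then (1 : ℝ) else 0) -
              smoothInd (k ^ μ₂) (k ^ μ₀) Hs u₀ (m * n) * smoothInd (k ^ μ₂) (k ^ μ₀) Hs u₁ (m * n + m * r))| *
              Fintype.card d := by
          refine (norm_sum_le _ _).trans (sum_le_sum fun u₀ _ => (norm_sum_le _ _).trans (sum_le_sum fun u₁ _ => ?_))
          rw [norm_mul, Complex.norm_real, Real.norm_eq_abs]
          exact mul_le_mul_of_nonneg_left (norm_wordTrace_le U f k μ₀ μ₁ μ₂ s n r u₀ u₁) (abs_nonneg _)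
      _ = (∑ u₀ ∈ range K', ∑ u₁ ∈ range K',
            |((if m * n % k ^ μ₂ / k ^ μ₀ = u₀ then (1 : ℝ) else 0) *
                (if (m * n + m * r) % k ^ μ₂ / k ^ μ₀ = u₁ then (1 : ℝ) else 0) -
              smoothInd (k ^ μ₂) (k ^ μ₀) Hs u₀ (m * n) * smoothInd (k ^ μ₂) (k ^ μ₀) Hs u₁ (m * n + m * r))|) *
            Fintype.card d := by
          rw [sum_mul]; exact sum_congr rfl fun u₀ _ => by rw [sum_mul]
      _ ≤ (2 * min 1 ((k ^ μ₂ : ℕ) / (Hs * gridDist (k ^ μ₀) (m * n)) : ℝ) +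
            2 * min 1 ((k ^ μ₂ : ℕ) / (Hs * gridDist (k ^ μ₀) (m * n + m * r)) : ℝ)) * Fintype.card d :=
          mul_le_mul_of_nonneg_right h2 (Nat.cast_nonneg _)
      _ = _ := by push_cast; ring
  rw [hdiff, mul_sum]
  refine (norm_sum_le _ _).trans (sum_le_sum fun r _ => ?_)
  rw [mul_sum]
  refine (norm_sum_le _ _).trans (sum_le_sum fun n _ => ?_)
  rw [mul_sum]
  exact (norm_sum_le _ _).trans (sum_le_sum fun m _ => hbound r n m)

end Literature.NumberTheory.LFunctions.MauduitRivat
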